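import Mathlib
import HarnessLib

/-!
# Stub `stub_dissipationTop` of the line `potential-flow-essential-singularity`
# (crux `MarginalStabilityChain.StretchedVortexRows`, stmt-AnomalousDissipation-3009)

Sorry-free discharge of the registered stub `stub_dissipationTop` (Stub 7) of the lead's skeleton
for the thesis decl `Summit.AnomalousDissipation.AnomalousDissipation.Theses.MarginalStabilityChain.
StretchedVortexRows`.

**Statement.** Let `Φ : ℂ → ℂ` be entire and `L > 0`. Assume that on the vertical line `x = L/2`
the values `Φ(L/2 + iy)`, `y ≥ 0`, are bounded in norm by `B`, while for every `M` there is a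
height `Y` such that every horizontal line at height `y ≥ Y` carries a point `x ∈ (0, L/2)` with
`‖Φ(x + iy)‖ ≥ M`. Then the iterated Lebesgue integral `∫⁻_{x ∈ (0,L]} ∫⁻_{y ∈ ℝ} ‖Φ'(x+iy)‖²`
equals `⊤`.

**Proof.** Pure measure theory plus one-variable calculus.
1. `Φ'` is continuous (an entire function is `C^∞`), so the integrand is jointly measurable and
   Tonelli (`MeasureTheory.lintegral_lintegral_swap`) exchanges the two integrals.
2. Take `M := B + L + 1` and the corresponding height `Y`. For `y ≥ max Y 0` pick `x₀ ∈ (0, L/2)`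
   with `‖Φ(x₀ + iy)‖ ≥ B + L + 1`; since `‖Φ(L/2 + iy)‖ ≤ B`, the increment of the real slice
   `h(s) = Φ(s + iy)` over `[x₀, L/2]` has norm `≥ L + 1`. The slice has the continuous derivative
   `h'(s) = Φ'(s + iy)`, so the fundamental theorem of calculus gives
   `L + 1 ≤ ‖h(L/2) - h(x₀)‖ ≤ ∫_{x₀}^{L/2} ‖h'‖`, and integrating the pointwise inequality
   `‖h'‖² ≥ 2‖h'‖ - 1` yields `∫_{x₀}^{L/2} ‖h'‖² ≥ 2(L + 1) - (L/2 - x₀) ≥ 1`. Hence the `x`-slice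
   lintegral over `(0, L] ⊇ (x₀, L/2]` is at least `1` for every `y ≥ max Y 0`.
3. Integrating this bound over `y ∈ [max Y 0, ∞)`, a set of infinite Lebesgue measure
   (`Real.volume_Ici`), gives `⊤`.

References: standard real analysis (Tonelli's theorem; the fundamental theorem of calculus for the
Bochner integral, `intervalIntegral.integral_eq_sub_of_hasDerivAt`). No named facts are used.
-/

set_option linter.dupNamespace false

noncomputable section

open scoped Topology ENNReal Real
open Filter Set Function MeasureTheory Complex

namespace Summit.AnomalousDissipation.AnomalousDissipation.Theorems
namespace MarginalStabilityChainStretchedVortexRows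
namespace PotentialFlow

/-! ## Calculus on horizontal slices -/

/-- Slice derivative: for an entire `Φ` and a fixed height `y`, the real slice `s ↦ Φ(s + iy)` has
derivative `Φ'(s + iy)` at every real `s` (chain rule with the translation `z ↦ z + iy` and the
inclusion `ℝ → ℂ`). [folklore] -/
theorem dissipationTop_hasDerivAt_slice (Φ : ℂ → ℂ) (hΦ : Differentiable ℂ Φ) (y s : ℝ) :
    HasDerivAt (fun t : ℝ => Φ ((t : ℂ) + (y : ℂ) * I)) (deriv Φ ((s : ℂ) + (y : ℂ) * I)) s := by
  have h1 : HasDerivAt Φ (deriv Φ ((s : ℂ) + (y : ℂ) * I)) ((s : ℂ) + (y : ℂ) * I) :=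
    (hΦ _).hasDerivAt
  have h2 : HasDerivAt (fun z : ℂ => Φ (z + (y : ℂ) * I)) (deriv Φ ((s : ℂ) + (y : ℂ) * I))
      (s : ℂ) :=
    HasDerivAt.comp_add_const (s : ℂ) ((y : ℂ) * I) h1
  exact h2.comp_ofReal

/-- Continuity of the slice derivative `s ↦ Φ'(s + iy)` of an entire `Φ` (an entire function is
`C¹`, so `Φ'` is continuous). [folklore] -/
theorem dissipationTop_continuous_slice (Φ : ℂ → ℂ) (hΦ : Differentiable ℂ Φ) (y : ℝ) :
    Continuous fun s : ℝ => deriv Φ ((s : ℂ) + (y : ℂ) * I) :=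
  (hΦ.contDiff (n := 1)).continuous_deriv_one.comp' (by fun_prop)

/-- Mean-square lower bound on a segment: if `h : ℝ → ℂ` has the continuous derivative `h'`
everywhere and `D ≤ ‖h b - h a‖` with `a ≤ b`, then `2 D - (b - a) ≤ ∫_a^b ‖h'‖²`.  Indeed
`D ≤ ‖h b - h a‖ = ‖∫_a^b h'‖ ≤ ∫_a^b ‖h'‖` by the fundamental theorem of calculus, and one
integrates the pointwise inequality `2‖h'‖ - 1 ≤ ‖h'‖²`. [folklore] -/
theorem dissipationTop_meanSquare {h h' : ℝ → ℂ} {a b D : ℝ} (hab : a ≤ b)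
    (hderiv : ∀ s : ℝ, HasDerivAt h (h' s) s) (hcont : Continuous h') (hD : D ≤ ‖h b - h a‖) :
    2 * D - (b - a) ≤ ∫ s in a..b, ‖h' s‖ ^ 2 := by
  have hint : IntervalIntegrable h' volume a b := hcont.intervalIntegrable _ _
  have hFTC : ∫ s in a..b, h' s = h b - h a :=
    intervalIntegral.integral_eq_sub_of_hasDerivAt (fun s _ => hderiv s) hint
  have hJ : D ≤ ∫ s in a..b, ‖h' s‖ := by
    calc D ≤ ‖h b - h a‖ := hD
      _ = ‖∫ s in a..b, h' s‖ := by rw [hFTC]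
      _ ≤ ∫ s in a..b, ‖h' s‖ := intervalIntegral.norm_integral_le_integral_norm hab
  have hint1 : IntervalIntegrable (fun s => ‖h' s‖) volume a b := hint.norm
  have hint2 : IntervalIntegrable (fun s => ‖h' s‖ ^ 2) volume a b :=
    (hcont.norm.pow 2).intervalIntegrable _ _
  have hint3 : IntervalIntegrable (fun s => 2 * ‖h' s‖ - 1) volume a b :=
    (hint1.const_mul 2).sub intervalIntegrable_const
  have hmono : (∫ s in a..b, (2 * ‖h' s‖ - 1)) ≤ ∫ s in a..b, ‖h' s‖ ^ 2 := by
    refine intervalIntegral.integral_mono_on hab hint3 hint2 fun s _ => ?_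
    show 2 * ‖h' s‖ - 1 ≤ ‖h' s‖ ^ 2
    nlinarith [sq_nonneg (‖h' s‖ - 1)]
  have hcalc : (∫ s in a..b, (2 * ‖h' s‖ - 1)) = 2 * (∫ s in a..b, ‖h' s‖) - (b - a) := by
    rw [intervalIntegral.integral_sub (hint1.const_mul 2) intervalIntegrable_const,
      intervalIntegral.integral_const_mul, intervalIntegral.integral_const, smul_eq_mul, mul_one]
  linarith

/-! ## The stub -/

/-- **Stub 7** (`stub_dissipationTop`). Infinite Dirichlet integral from two-point data on far
horizontal lines: if an entire `Φ` is bounded (by `B`) at `x = L/2` for `y ≥ 0` but eventually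
exceeds every bound somewhere inside `(0, L/2)` as `y → +∞`, then
`∫⁻_{x ∈ (0,L]} ∫⁻_y ‖Φ'(x+iy)‖² = ⊤`: by the mean-square bound on `[x(y), L/2]` the `x`-slice
integral is `≥ 1` for all large `y`, then Tonelli. [folklore] -/
theorem stub_dissipationTop (Φ : ℂ → ℂ) (hΦ : Differentiable ℂ Φ) (L : ℝ) (hL : 0 < L) (B : ℝ)
    (hB : ∀ y : ℝ, 0 ≤ y → ‖Φ (((L / 2 : ℝ) : ℂ) + (y : ℂ) * I)‖ ≤ B)
    (hM : ∀ M : ℝ, ∃ Y : ℝ, ∀ y : ℝ, Y ≤ y →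
      ∃ x : ℝ, x ∈ Set.Ioo 0 (L / 2) ∧ M ≤ ‖Φ ((x : ℂ) + (y : ℂ) * I)‖) :
    (∫⁻ x in Ioc 0 L, ∫⁻ y : ℝ, ENNReal.ofReal (‖deriv Φ ((x : ℂ) + (y : ℂ) * I)‖ ^ 2)) = ⊤ := by
  -- `Φ'` is continuous, so the integrand is jointly measurable
  have hcont : Continuous (deriv Φ) := (hΦ.contDiff (n := 1)).continuous_deriv_one
  have hmeas : Measurable
      (uncurry fun x y : ℝ => ENNReal.ofReal (‖deriv Φ ((x : ℂ) + (y : ℂ) * I)‖ ^ 2)) := by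
    have h1 : Continuous fun p : ℝ × ℝ => deriv Φ ((p.1 : ℂ) + (p.2 : ℂ) * I) :=
      hcont.comp' (by fun_prop)
    exact (ENNReal.continuous_ofReal.comp' (h1.norm.pow 2)).measurable
  -- Tonelli: swap the order of integration
  rw [lintegral_lintegral_swap hmeas.aemeasurable]
  -- slice lower bound on far horizontal lines
  obtain ⟨Y, hY⟩ := hM (B + L + 1)
  have hslice : ∀ y : ℝ, max Y 0 ≤ y →
      (1 : ℝ≥0∞) ≤ ∫⁻ x in Ioc 0 L, ENNReal.ofReal (‖deriv Φ ((x : ℂ) + (y : ℂ) * I)‖ ^ 2) := by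
    intro y hy
    have hy0 : 0 ≤ y := le_trans (le_max_right _ _) hy
    obtain ⟨x₀, ⟨hx₀0, hx₀L⟩, hMx⟩ := hY y (le_trans (le_max_left _ _) hy)
    have hab : x₀ ≤ L / 2 := hx₀L.le
    have hD : L + 1 ≤ ‖Φ (((L / 2 : ℝ) : ℂ) + (y : ℂ) * I) - Φ ((x₀ : ℂ) + (y : ℂ) * I)‖ := by
      have h1 := hB y hy0
      have h2 := norm_sub_norm_le (Φ ((x₀ : ℂ) + (y : ℂ) * I)) (Φ (((L / 2 : ℝ) : ℂ) + (y : ℂ) * I))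
      rw [norm_sub_rev] at h2
      linarith
    have hms : 2 * (L + 1) - (L / 2 - x₀) ≤
        ∫ s in x₀..(L / 2), ‖deriv Φ ((s : ℂ) + (y : ℂ) * I)‖ ^ 2 :=
      dissipationTop_meanSquare hab (dissipationTop_hasDerivAt_slice Φ hΦ y)
        (dissipationTop_continuous_slice Φ hΦ y) hD
    have hS : (1 : ℝ) ≤ ∫ s in x₀..(L / 2), ‖deriv Φ ((s : ℂ) + (y : ℂ) * I)‖ ^ 2 := by
      linarith
    have hsub : Ioc x₀ (L / 2) ⊆ Ioc 0 L :=
      fun t ht => ⟨hx₀0.trans ht.1, ht.2.trans (half_le_self hL.le)⟩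
    have hint : IntegrableOn (fun s : ℝ => ‖deriv Φ ((s : ℂ) + (y : ℂ) * I)‖ ^ 2)
        (Ioc x₀ (L / 2)) :=
      ((dissipationTop_continuous_slice Φ hΦ y).norm.pow 2).integrableOn_Ioc
    calc (1 : ℝ≥0∞) = ENNReal.ofReal 1 := ENNReal.ofReal_one.symm
      _ ≤ ENNReal.ofReal (∫ s in x₀..(L / 2), ‖deriv Φ ((s : ℂ) + (y : ℂ) * I)‖ ^ 2) :=
          ENNReal.ofReal_le_ofReal hS
      _ = ∫⁻ s in Ioc x₀ (L / 2), ENNReal.ofReal (‖deriv Φ ((s : ℂ) + (y : ℂ) * I)‖ ^ 2) := by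
          rw [intervalIntegral.integral_of_le hab,
            ofReal_integral_eq_lintegral_ofReal hint (ae_of_all _ fun s => sq_nonneg _)]
      _ ≤ ∫⁻ s in Ioc 0 L, ENNReal.ofReal (‖deriv Φ ((s : ℂ) + (y : ℂ) * I)‖ ^ 2) :=
          lintegral_mono_set hsub
  -- integrate the slice bound over `y ∈ [max Y 0, ∞)`, a set of infinite measure
  refine top_unique ?_
  calc (⊤ : ℝ≥0∞) = ∫⁻ _ in Ici (max Y 0), (1 : ℝ≥0∞) := by
        rw [setLIntegral_const, Real.volume_Ici, one_mul]
    _ ≤ ∫⁻ y in Ici (max Y 0),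
          ∫⁻ x in Ioc 0 L, ENNReal.ofReal (‖deriv Φ ((x : ℂ) + (y : ℂ) * I)‖ ^ 2) :=
        setLIntegral_mono' measurableSet_Ici fun y hy => hslice y (mem_Ici.mp hy)
    _ ≤ ∫⁻ y : ℝ, ∫⁻ x in Ioc 0 L, ENNReal.ofReal (‖deriv Φ ((x : ℂ) + (y : ℂ) * I)‖ ^ 2) :=
        setLIntegral_le_lintegral _ _

end PotentialFlow
end MarginalStabilityChainStretchedVortexRows
end Summit.AnomalousDissipation.AnomalousDissipation.Theorems
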